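import Literature.Analysis.FluidPDE.PeriodicNSOrbitPersistsProofs
import Summits.AnomalousDissipation.AnomalousDissipation.Theorems.BaireTransferRobustLoudUpgradeLine
import Summits.AnomalousDissipation.AnomalousDissipation.Theorems.BaireTransferRobustLoudUpgradeStubSteadyPersist

/-!
# Stub `stub_lsFamilyPeriodic` of the line `malkin-cone-group-orbits` (crux stmt-AnomalousDissipation-1144, companion c3),
# part A: vectors of the space–time lattice attached to classical fields, identification, realisation

Helper file (pure proofs) for the periodic Lyapunov–Schmidt family.  On the space–time Fourier lattice of
`TimePeriodicNSLattice*` (state space `W ⊂ ℓ²(ℤ × ℤ³; ℂ³)` of `TimePeriodicNSLatticeSpaces.exists_space`) we attach: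
the continuous linear FORCE MAP `c ↦ y_{f_c}` of the finite trigonometric-polynomial family `P_S` (`exists_forceMapST`);
the lattice vector of an admissible real `τ`-periodic space–time field (`exists_fieldVec`, `exists_fieldVecW`); the
IDENTIFICATION of the coefficients of a synthesis equal to a combination `z₁ ∂ₜu + z₂ v` (`coeff_eq_of_synth_eq_lincomb`);
and the REALISATION of a lattice solution close to the orbit as a classical periodic solution uniformly `H¹`-close to `u`
after the linear time rescaling (`witness_of_latticeSol`, the tail of `TimePeriodicLattice.persists_main` verbatim).
References: Iooss 1972 §2–3; Henry 1981 Ch. 8; Kielhöfer 2012 §I.8, §I.12; Chow–Hale 1982 §2.4.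
-/

-- `Summit.<Summit>.<Problem>` is the tree's mandated summit-side namespace (CONVENTIONS §2); for this
-- single-conjunct summit the two coincide, so the duplicate is deliberate.
set_option linter.dupNamespace false

noncomputable section

open scoped BigOperators Topology ENNReal NNReal ComplexConjugate
open Filter Set Function MeasureTheory UnitAddTorus

namespace Summit.AnomalousDissipation.AnomalousDissipation.Theorems.RobustLoudUpgrade.LsFamilyPeriodic

open Literature.Analysis.FunctionSpaces Literature.Analysis.FunctionSpaces.Torus
open Literature.Analysis.FunctionSpaces.EuclideanSpace
open Literature.Analysis.FluidPDE
open Literature.Analysis.FluidPDE.ScalarFourier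
open Literature.Analysis.FluidPDE.TimePeriodicLattice
open Summit.AnomalousDissipation.AnomalousDissipation.Theses.BaireTransfer

-- NOTATION START (verbatim from `PeriodicNSOrbitPersistsProofs`)
/-- Local notation: the parabolic weight `Λ(n, k) = |n| + |k|²`. -/
local notation:max "Λ" m:max => (|((Prod.fst m : ℤ) : ℝ)| + freqNormSq (Prod.snd m))

/-- Local notation: the convective symbol on `ℤ × ℤ³` (as in `TimePeriodicNSLattice`). -/
local notation:max "𝐍[" a ", " b "]" m:max =>
  (WithLp.toLp 2 (fun p : Fin 3 => ∑ j : Fin 3, ∑' m' : ℤ × (Fin 3 → ℤ),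
    a m' j * (dsym j (Prod.snd m - Prod.snd m') * b (m - m') p)) : EuclideanSpace ℂ (Fin 3))

/-- Local notation: division by the weight. -/
local notation:max "𝐜" x:max => (fun mm : ℤ × (Fin 3 → ℤ) =>
  ((((|((Prod.fst mm : ℤ) : ℝ)| + freqNormSq (Prod.snd mm))⁻¹ : ℝ) : ℂ) • x mm))

/-- Local notation: multiplication by the weight. -/
local notation:max "𝐬" x:max => (fun mm : ℤ × (Fin 3 → ℤ) =>
  ((((|((Prod.fst mm : ℤ) : ℝ)| + freqNormSq (Prod.snd mm)) : ℝ) : ℂ) • x mm))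

/-- Local notation: the family of coefficients of `x ∈ W ⊂ ℓ²`. -/
local notation:max "𝐰" x:max =>
  (((x : lp (fun _ : ℤ × (Fin 3 → ℤ) => EuclideanSpace ℂ (Fin 3)) 2)) : ℤ × (Fin 3 → ℤ) → EuclideanSpace ℂ (Fin 3))

/-- Local notation: the extension `K ↦ c (K₀, tail K)` of a lattice family to `ℤ⁴`. -/
local notation:max "𝐄" c:max => (fun K : Fin 4 → ℤ => c ((K 0, Fin.tail K) : ℤ × (Fin 3 → ℤ)))

/-- Local notation: the lattice family `û(n,k) = 𝓕(complexify ∘ (U − m₀))(n,k)`. -/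
local notation:max "𝐮[" U ", " m₀ "]" => (fun mm : ℤ × (Fin 3 → ℤ) =>
  mFourierCoeff (EuclideanSpace.complexify ∘ fun y : UnitAddTorus (Fin 4) => U y - m₀)
    (Fin.cons (Prod.fst mm) (Prod.snd mm) : Fin 4 → ℤ))

/-- Local notation: the force family `y_F(n,k) = [k ≠ 0][n = 0] 𝓕(complexify ∘ F)(k)`. -/
local notation:max "𝐲" F:max => (fun mm : ℤ × (Fin 3 → ℤ) =>
  (ite (Prod.snd mm = 0) (0 : EuclideanSpace ℂ (Fin 3))
    (ite (Prod.fst mm = 0) (mFourierCoeff (EuclideanSpace.complexify ∘ F) (Prod.snd mm)) 0)))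

/-- Local notation: the lattice family of the orbit `u` with period `τ`. -/
local notation:max "𝐨[" τ ", " u "]" => (fun mm : ℤ × (Fin 3 → ℤ) =>
  mFourierCoeff (EuclideanSpace.complexify ∘ fun y : UnitAddTorus (Fin 4) => Torus.timeRoll τ u y - ∫ x, u 0 x)
    (Fin.cons (Prod.fst mm) (Prod.snd mm) : Fin 4 → ℤ))
/-- Local notation: the time multiplier `dₛ(n,k) = 2πi n / Λ(n,k)`. -/
local notation "dS" => (fun mm : ℤ × (Fin 3 → ℤ) =>
  (2 * Real.pi * Complex.I * ((Prod.fst mm : ℤ) : ℂ)) * ((((|((Prod.fst mm : ℤ) : ℝ)| + freqNormSq (Prod.snd mm)) : ℝ) : ℂ))⁻¹)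

/-- Local notation: the Stokes–drift multiplier `(4π²ν|k|² + 2πi m₀·k) / Λ(n,k)`. -/
local notation "dL[" ν ", " m₀ "]" => (fun mm : ℤ × (Fin 3 → ℤ) =>
  (((4 * Real.pi ^ 2 * ν * freqNormSq (Prod.snd mm) : ℝ) : ℂ) +
      2 * Real.pi * Complex.I * (∑ jj : Fin 3, ((m₀ jj : ℝ) : ℂ) * (((Prod.snd mm) jj : ℤ) : ℂ))) *
    ((((|((Prod.fst mm : ℤ) : ℝ)| + freqNormSq (Prod.snd mm)) : ℝ) : ℂ))⁻¹)

/-- Local notation: the symbol `σ_om(n,k) = 2πiomn + 4π²ν|k|² + 2πi m₀·k`. -/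
local notation "σ[" om ", " ν ", " m₀ "]" => (fun mm : ℤ × (Fin 3 → ℤ) =>
  2 * Real.pi * Complex.I * ((om : ℝ) : ℂ) * ((Prod.fst mm : ℤ) : ℂ) +
    (((4 * Real.pi ^ 2 * ν * freqNormSq (Prod.snd mm) : ℝ)) : ℂ) +
    2 * Real.pi * Complex.I * (∑ jj : Fin 3, ((m₀ jj : ℝ) : ℂ) * (((Prod.snd mm) jj : ℤ) : ℂ)))
-- NOTATION END

variable {W : Submodule ℝ (lp (fun _ : ℤ × (Fin 3 → ℤ) => EuclideanSpace ℂ (Fin 3)) 2)}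

/-! ## §1 Vectors of `W` attached to classical fields -/

section Vectors

variable (hW : ∀ x : lp (fun _ : ℤ × (Fin 3 → ℤ) => EuclideanSpace ℂ (Fin 3)) 2, x ∈ W ↔
      (∀ n : ℤ, (x : ℤ × (Fin 3 → ℤ) → EuclideanSpace ℂ (Fin 3)) (n, 0) = 0) ∧
      (∀ mm : ℤ × (Fin 3 → ℤ), (∑ jj : Fin 3, ((mm.2 jj : ℤ) : ℂ) *
        ((x : ℤ × (Fin 3 → ℤ) → EuclideanSpace ℂ (Fin 3)) mm) jj) = 0) ∧
      (∀ mm : ℤ × (Fin 3 → ℤ), (x : ℤ × (Fin 3 → ℤ) → EuclideanSpace ℂ (Fin 3)) (-mm) =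
        conjVec ((x : ℤ × (Fin 3 → ℤ) → EuclideanSpace ℂ (Fin 3)) mm)))

/-- **Lattice data of an admissible real `τ`-periodic space–time field** `Z` (jointly smooth, solenoidal mean-zero
slices): zero spatial modes, transversality, conjugate symmetry and rapid decay of `𝐮[timeRoll τ Z, 0]`. [folklore] -/
theorem fieldFamily_admissible {τ : ℝ} {Z : ℝ → UnitAddTorus (Fin 3) → EuclideanSpace ℝ (Fin 3)}
    (hZ : IsSmoothSpaceTimeOn univ Z) (hper : Function.Periodic Z τ) (hdiv : ∀ t, IsDivFree (Z t))
    (h0 : ∀ t, HasZeroMean (Z t)) :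
    (∀ n : ℤ, 𝐮[timeRoll τ Z, 0] ((n, 0) : ℤ × (Fin 3 → ℤ)) = 0) ∧
    (∀ m : ℤ × (Fin 3 → ℤ), (∑ jj : Fin 3, ((m.2 jj : ℤ) : ℂ) * (𝐮[timeRoll τ Z, 0] m) jj) = 0) ∧
    (∀ m : ℤ × (Fin 3 → ℤ), 𝐮[timeRoll τ Z, 0] (-m) = conjVec (𝐮[timeRoll τ Z, 0] m)) ∧
    RapidDecay (mFourierCoeff (complexify ∘ fun y => timeRoll τ Z y - 0)) := by
  have hU : IsSmooth (timeRoll τ Z) := isSmooth_timeRoll hZ hper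
  refine ⟨fun n => ?_, fun m => ?_, fun m => ?_, ?_⟩
  · refine coeff_sub_mean_cons_zero hU (fun c => ?_) n
    obtain ⟨s, rfl⟩ := QuotientAddGroup.mk_surjective c
    rw [show (QuotientAddGroup.mk s : UnitAddCircle) = ((s : ℝ) : UnitAddCircle) from rfl, timeSlice_timeRoll hper]
    exact h0 _
  · refine kdot_coeff_sub_mean hU (fun y => ?_) m
    obtain ⟨s, x, rfl⟩ := exists_eq_cons y
    rw [← divergence_timeSlice, timeSlice_timeRoll hper]
    exact hdiv (τ * s) x
  · exact coeff_sub_mean_neg hU m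
  · have hV : IsSmooth (fun y => timeRoll τ Z y - 0) := hU.sub (isSmooth_const _)
    have hVc : IsSmooth (complexify ∘ fun y => timeRoll τ Z y - 0) := hV.comp_clm complexify.toContinuousLinearMap
    exact hVc.rapidDecay_mFourierCoeff

include hW in
/-- **The (unweighted) lattice vector of an admissible real `τ`-periodic space–time field** `Z`:
an element `Y ∈ W` with coefficients `𝐮[timeRoll τ Z, 0]` (used for border fields `H`). [folklore] -/
theorem exists_fieldVec {τ : ℝ} {Z : ℝ → UnitAddTorus (Fin 3) → EuclideanSpace ℝ (Fin 3)}
    (hZ : IsSmoothSpaceTimeOn univ Z) (hper : Function.Periodic Z τ) (hdiv : ∀ t, IsDivFree (Z t))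
    (h0 : ∀ t, HasZeroMean (Z t)) :
    ∃ Y : W, 𝐰 Y = 𝐮[timeRoll τ Z, 0] := by
  obtain ⟨hz, ht, hc, hr⟩ := fieldFamily_admissible hZ hper hdiv h0
  have hmom : ∀ N : ℕ, ∑' m : ℤ × (Fin 3 → ℤ), ENNReal.ofReal ((Λ m) ^ N) * ‖(𝐬 (𝐮[timeRoll τ Z, 0])) m‖ₑ ^ 2 ≠ ⊤ :=
    fun N => moments_of_rapidDecay (C := mFourierCoeff (complexify ∘ fun y => timeRoll τ Z y - 0)) hr N
  have h2 : ∑' m : ℤ × (Fin 3 → ℤ), ‖(𝐮[timeRoll τ Z, 0]) m‖ₑ ^ 2 ≠ ⊤ := by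
    have h1 := hmom 0
    simp only [pow_zero, ENNReal.ofReal_one, one_mul] at h1
    exact ne_top_of_le_ne_top h1 (ENNReal.tsum_le_tsum fun m => by
      gcongr; exact enorm_le_enorm_sw (x := 𝐮[timeRoll τ Z, 0]) hz m)
  exact exists_memW hW h2 hz ht hc

include hW in
/-- **The weighted lattice vector** `Λ·𝐮[timeRoll τ Z, 0]` of an admissible real `τ`-periodic space–time field `Z` (the
state vector of a kernel field `v`, in the scaling of the orbit's `x₀ = Λû`). [folklore] -/
theorem exists_fieldVecW {τ : ℝ} {Z : ℝ → UnitAddTorus (Fin 3) → EuclideanSpace ℝ (Fin 3)}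
    (hZ : IsSmoothSpaceTimeOn univ Z) (hper : Function.Periodic Z τ) (hdiv : ∀ t, IsDivFree (Z t))
    (h0 : ∀ t, HasZeroMean (Z t)) :
    ∃ X : W, 𝐰 X = 𝐬 (𝐮[timeRoll τ Z, 0]) := by
  obtain ⟨hz, ht, hc, hr⟩ := fieldFamily_admissible hZ hper hdiv h0
  have hmom : ∀ N : ℕ, ∑' m : ℤ × (Fin 3 → ℤ), ENNReal.ofReal ((Λ m) ^ N) * ‖(𝐬 (𝐮[timeRoll τ Z, 0])) m‖ₑ ^ 2 ≠ ⊤ :=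
    fun N => moments_of_rapidDecay (C := mFourierCoeff (complexify ∘ fun y => timeRoll τ Z y - 0)) hr N
  have h2 : ∑' m : ℤ × (Fin 3 → ℤ), ‖(𝐬 (𝐮[timeRoll τ Z, 0])) m‖ₑ ^ 2 ≠ ⊤ := by
    have h1 := hmom 0; simpa only [pow_zero, ENNReal.ofReal_one, one_mul] using h1
  exact exists_memW hW h2 (sw_zero_mode (x := 𝐮[timeRoll τ Z, 0]) hz) (sw_transversal (x := 𝐮[timeRoll τ Z, 0]) ht)
    (sw_neg (x := 𝐮[timeRoll τ Z, 0]) hc)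

include hW in
/-- **The force map of the family `P_S` on the space–time lattice**: a continuous real-linear `Fm : P_S → W` with
coefficients `y_{f_c}` (the force enters the lattice equation on the slice `n = 0`). [folklore] -/
theorem exists_forceMapST (S : Finset (Fin 3 → ℤ)) :
    ∃ Fm : Coeff S →L[ℝ] W, ∀ c : Coeff S, 𝐰 (Fm c) = 𝐲 (force S c) := by
  have hyf2 : ∀ c : Coeff S, ∑' m : ℤ × (Fin 3 → ℤ), ‖(𝐲 (force S c)) m‖ₑ ^ 2 ≠ ⊤ := fun c => by
    have := tsum_moment_yf_ne_top (SteadyPersist.isSmooth_force' c) 0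
    simpa only [pow_zero, ENNReal.ofReal_one, one_mul] using this
  have hmem : ∀ c : Coeff S, ∃ X : W, 𝐰 X = 𝐲 (force S c) := fun c =>
    exists_memW hW (hyf2 c) (yf_zero_mode (force S c))
      (yf_transversal (SteadyPersist.isSmooth_force' c) (SteadyPersist.isDivFree_force' c))
      (yf_neg (SteadyPersist.isSmooth_force' c).continuous)
  choose T hT using hmem
  have hfadd : ∀ c₁ c₂ : Coeff S, force S (c₁ + c₂) = force S c₁ + force S c₂ := fun c₁ c₂ =>
    SteadyLattice.projForce_add c₁ c₂
  have hfsmul : ∀ (a : ℝ) (c : Coeff S), force S (a • c) = a • force S c := fun a c =>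
    SteadyLattice.projForce_smul a c
  have hadd : ∀ c₁ c₂ : Coeff S, T (c₁ + c₂) = T c₁ + T c₂ := by
    intro c₁ c₂
    refine W_ext fun m => ?_
    rw [coeW_add, Pi.add_apply, hT, hT, hT]
    by_cases hm : m.2 = 0
    · simp [hm]
    · rw [yf_of_snd_ne_zero _ hm, yf_of_snd_ne_zero _ hm, yf_of_snd_ne_zero _ hm]
      split_ifs
      · have e : (complexify ∘ force S (c₁ + c₂) : UnitAddTorus (Fin 3) → EuclideanSpace ℂ (Fin 3)) =
            (complexify ∘ force S c₁) + (complexify ∘ force S c₂) := by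
          funext y; simp [hfadd]
        rw [e, mFourierCoeff_add (SteadyPersist.isSmooth_force' c₁).complexify_comp.integrable
          (SteadyPersist.isSmooth_force' c₂).complexify_comp.integrable]
      · simp
  have hsmul : ∀ (a : ℝ) (c : Coeff S), T (a • c) = a • T c := by
    intro a c
    refine W_ext fun m => ?_
    rw [coeW_smul, Pi.smul_apply, hT, hT]
    by_cases hm : m.2 = 0
    · simp [hm]
    · rw [yf_of_snd_ne_zero _ hm, yf_of_snd_ne_zero _ hm]
      split_ifs
      · have e : (complexify ∘ force S (a • c) : UnitAddTorus (Fin 3) → EuclideanSpace ℂ (Fin 3)) =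
            (a : ℂ) • (complexify ∘ force S c) := by
          funext y
          simp only [Function.comp_apply, hfsmul, Pi.smul_apply]
          exact (SteadyLattice.coe_smul_complexify a _).symm
        rw [e, mFourierCoeff_const_smul]
        exact Complex.coe_smul _ _
      · simp
  set L : Coeff S →ₗ[ℝ] W := { toFun := T, map_add' := hadd, map_smul' := hsmul } with hL
  exact ⟨LinearMap.toContinuousLinearMap L, fun c => hT c⟩

end Vectors

/-! ## §2 Identification of the coefficients of a synthesis equal to `z₁ ∂ₜu + z₂ v` -/

section Identify

variable {τ : ℝ} {u v : ℝ → UnitAddTorus (Fin 3) → EuclideanSpace ℝ (Fin 3)} {h : ℤ × (Fin 3 → ℤ) → EuclideanSpace ℂ (Fin 3)}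

/-- **Identification**: if the synthesis `w(t,x) = F_{𝐄 h}(t/τ, x)` equals `z₁ ∂ₜu + z₂ v` for the `τ`-periodic orbit `u`
and a `τ`-periodic smooth real field `v`, then `h(n,k) = (z₁ τ⁻¹ 2πi n) û(n,k) + z₂ v̂(n,k)`. [folklore] -/
theorem coeff_eq_of_synth_eq_lincomb (hτ : 0 < τ) (hsu : IsSmoothSpaceTimeOn univ u) (hper : Function.Periodic u τ)
    (hsv : IsSmoothSpaceTimeOn univ v) (hperv : Function.Periodic v τ)
    (hhr : RapidDecay (𝐄 h)) (m₀ : EuclideanSpace ℝ (Fin 3)) {z₁ z₂ : ℂ}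
    (hw : ∀ t x, fourierSynth (𝐄 h) (Fin.cons (((τ⁻¹ * t : ℝ)) : UnitAddCircle) x) =
      z₁ • Torus.realToComplex (Torus.timeDerivWithin univ u t x) + z₂ • Torus.realToComplex (v t x)) (m : ℤ × (Fin 3 → ℤ)) :
    h m = (z₁ * ((τ⁻¹ : ℝ) : ℂ) * (2 * Real.pi * Complex.I * (m.1 : ℂ))) • 𝐮[timeRoll τ u, m₀] m +
      z₂ • 𝐮[timeRoll τ v, 0] m := by
  have hU : IsSmooth (timeRoll τ u) := isSmooth_timeRoll hsu hper
  have hV : IsSmooth (timeRoll τ v) := isSmooth_timeRoll hsv hperv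
  have hV0 : IsSmooth (fun y => timeRoll τ v y - 0) := hV.sub (isSmooth_const _)
  have hV0c : IsSmooth (complexify ∘ fun y => timeRoll τ v y - 0) := hV0.comp_clm complexify.toContinuousLinearMap
  have hdUc : IsSmooth (complexify ∘ Torus.partialDeriv 0 (timeRoll τ u)) :=
    (hU.partialDeriv 0).comp_clm complexify.toContinuousLinearMap
  -- `W = (z₁ τ⁻¹) • complexify ∘ ∂₀ U + z₂ • complexify ∘ (V − 0)` on `T⁴`
  have hfun : fourierSynth (𝐄 h) = (z₁ * ((τ⁻¹ : ℝ) : ℂ)) • (complexify ∘ Torus.partialDeriv 0 (timeRoll τ u)) +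
      z₂ • (complexify ∘ fun y => timeRoll τ v y - 0) := by
    funext y
    obtain ⟨s, x, rfl⟩ := exists_eq_cons y
    have h1 := hw (τ * s) x
    rw [show τ⁻¹ * (τ * s) = s by field_simp] at h1
    have hτc : (τ : ℂ) ≠ 0 := by exact_mod_cast hτ.ne'
    rw [h1, Pi.add_apply, Pi.smul_apply, Pi.smul_apply, Function.comp_apply, Function.comp_apply,
      partialDeriv_zero_timeRoll hsu hper s x, LinearIsometry.map_smul, timeRoll_cons hperv s x, sub_zero,
      SteadyLattice.realToComplex_eq_complexify, SteadyLattice.realToComplex_eq_complexify, ← Complex.coe_smul τ,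
      smul_smul, Complex.ofReal_inv, mul_assoc, inv_mul_cancel₀ hτc, mul_one]
  have hc := congrArg (fun g : UnitAddTorus (Fin 4) → EuclideanSpace ℂ (Fin 3) => mFourierCoeff g (Fin.cons m.1 m.2)) hfun
  simp only [hhr.mFourierCoeff_fourierSynth, Fin.cons_zero, Fin.tail_cons, Prod.mk.eta] at hc
  rw [mFourierCoeff_add (hdUc.integrable.smul _) (hV0c.integrable.smul _), mFourierCoeff_const_smul,
    mFourierCoeff_const_smul, coeff_partialDeriv_zero (m₀ := m₀) hU m, smul_smul] at hc
  exact hc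

/-- **Independence**: if `a (2πi n) û(n,k) + b v̂(n,k) = 0` for all `(n, k)` with `∂ₜu ≢ 0` and `v` not a complex
multiple of `∂ₜu`, then `a = b = 0` (Fourier injectivity on `T⁴`). [folklore] -/
theorem eq_zero_of_lincomb_family_eq_zero (hτ : 0 < τ) (hsu : IsSmoothSpaceTimeOn univ u) (hper : Function.Periodic u τ)
    (hsv : IsSmoothSpaceTimeOn univ v) (hperv : Function.Periodic v τ) (m₀ : EuclideanSpace ℝ (Fin 3))
    (hmov : ∃ t x, Torus.timeDerivWithin univ u t x ≠ 0)
    (hdeg : ¬ ∃ z : ℂ, ∀ t x, Torus.realToComplex (v t x) = z • Torus.realToComplex (Torus.timeDerivWithin univ u t x))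
    {a b : ℂ} (hab : ∀ m : ℤ × (Fin 3 → ℤ), a • ((2 * Real.pi * Complex.I * (m.1 : ℂ)) • 𝐮[timeRoll τ u, m₀] m) +
      b • 𝐮[timeRoll τ v, 0] m = 0) : a = 0 ∧ b = 0 := by
  have hU : IsSmooth (timeRoll τ u) := isSmooth_timeRoll hsu hper
  have hV : IsSmooth (timeRoll τ v) := isSmooth_timeRoll hsv hperv
  have hV0 : IsSmooth (fun y => timeRoll τ v y - 0) := hV.sub (isSmooth_const _)
  have hV0c : IsSmooth (complexify ∘ fun y => timeRoll τ v y - 0) := hV0.comp_clm complexify.toContinuousLinearMap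
  have hdUc : IsSmooth (complexify ∘ Torus.partialDeriv 0 (timeRoll τ u)) :=
    (hU.partialDeriv 0).comp_clm complexify.toContinuousLinearMap
  -- the smooth function `F = a • complexify ∘ ∂₀U + b • complexify ∘ V` has all coefficients zero
  set F : UnitAddTorus (Fin 4) → EuclideanSpace ℂ (Fin 3) :=
    a • (complexify ∘ Torus.partialDeriv 0 (timeRoll τ u)) + b • (complexify ∘ fun y => timeRoll τ v y - 0) with hF
  have hFc : Continuous F := ((hdUc.continuous.const_smul a).add (hV0c.continuous.const_smul b) :)
  have hF0 : F = 0 := by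
    refine eq_zero_of_forall_mFourierCoeff_eq_zero hFc fun K => ?_
    rw [← Fin.cons_self_tail K, hF, mFourierCoeff_add (hdUc.integrable.smul _) (hV0c.integrable.smul _),
      mFourierCoeff_const_smul, mFourierCoeff_const_smul, coeff_partialDeriv_zero (m₀ := m₀) hU (K 0, Fin.tail K)]
    exact hab (K 0, Fin.tail K)
  -- evaluate at `(t/τ, x)`: `a τ ∂ₜu + b v = 0`
  have hpt : ∀ t x, (a * (τ : ℂ)) • complexify (Torus.timeDerivWithin univ u t x) + b • complexify (v t x) = 0 := by
    intro t x
    have h1 := congrArg (fun G : UnitAddTorus (Fin 4) → EuclideanSpace ℂ (Fin 3) => G (Fin.cons (((τ⁻¹ * t : ℝ)) : UnitAddCircle) x)) hF0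
    simp only [hF, Pi.add_apply, Pi.smul_apply, Function.comp_apply, Pi.zero_apply] at h1
    rw [partialDeriv_zero_timeRoll hsu hper, timeRoll_cons hperv, sub_zero, show τ * (τ⁻¹ * t) = t by field_simp,
      LinearIsometry.map_smul, ← Complex.coe_smul τ, smul_smul] at h1
    exact h1
  have hτc : (τ : ℂ) ≠ 0 := by exact_mod_cast hτ.ne'
  by_cases hb : b = 0
  · refine ⟨?_, hb⟩
    by_contra ha
    obtain ⟨t, x, hne⟩ := hmov
    have h1 := hpt t x
    simp only [hb, zero_smul, add_zero] at h1
    rcases smul_eq_zero.1 h1 with h1 | h1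
    · exact (mul_ne_zero ha hτc) h1
    · apply hne
      have : complexify (Torus.timeDerivWithin univ u t x) = complexify (0 : EuclideanSpace ℝ (Fin 3)) := by
        rw [h1, LinearIsometry.map_zero]
      exact complexify.injective this
  · exfalso
    refine hdeg ⟨-(a * (τ : ℂ)) / b, fun t x => ?_⟩
    have h1 := hpt t x
    rw [add_eq_zero_iff_eq_neg'] at h1
    rw [SteadyLattice.realToComplex_eq_complexify, SteadyLattice.realToComplex_eq_complexify]
    -- `b • v = −(aτ) • ∂ₜu`
    have h2 : complexify (v t x) = b⁻¹ • (-((a * (τ : ℂ)) • complexify (Torus.timeDerivWithin univ u t x))) := by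
      rw [← h1, smul_smul, inv_mul_cancel₀ hb, one_smul]
    rw [h2, smul_neg, smul_smul, ← neg_smul]
    congr 1
    field_simp

end Identify


/-! ## Registered part (sub-goal `lsFamilyPeriodic_partA` of stmt-AnomalousDissipation-1144) -/

/-- **Registered sub-goal `lsFamilyPeriodic_partA`** (companion c3): the INDEPENDENCE of the phase family `(2πi n) û` and the
state family `v̂` of a field `v` that is not a complex multiple of `∂ₜu` (`∂ₜu ≢ 0`), notation-free form of
`eq_zero_of_lincomb_family_eq_zero`. [folklore] -/
theorem lsFamilyPeriodic_partA : ∀ (τ : ℝ) (u v : ℝ → UnitAddTorus (Fin 3) → EuclideanSpace ℝ (Fin 3)) (m₀ : EuclideanSpace ℝ (Fin 3)) (a b : ℂ), 0 < τ → Torus.IsSmoothSpaceTimeOn Set.univ u → Function.Periodic u τ → Torus.IsSmoothSpaceTimeOn Set.univ v → Function.Periodic v τ → (∃ t x, Torus.timeDerivWithin Set.univ u t x ≠ 0) → (¬ ∃ z : ℂ, ∀ t x, Torus.realToComplex (v t x) = z • Torus.realToComplex (Torus.timeDerivWithin Set.univ u t x)) → (∀ m : ℤ × (Fin 3 → ℤ),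 a • ((2 * Real.pi * Complex.I * (m.1 : ℂ)) • mFourierCoeff (EuclideanSpace.complexify ∘ fun y : UnitAddTorus (Fin 4) => Torus.timeRoll τ u y - m₀) (Fin.cons m.1 m.2)) + b • mFourierCoeff (EuclideanSpace.complexify ∘ fun y : UnitAddTorus (Fin 4) => Torus.timeRoll τ v y - 0) (Fin.cons m.1 m.2) = 0) → a = 0 ∧ b = 0 :=
  fun _ u v m₀ _ _ hτ hsu hper hsv hperv hmov hdeg hab =>
    eq_zero_of_lincomb_family_eq_zero (u := u) (v := v) hτ hsu hper hsv hperv m₀ hmov hdeg hab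

end Summit.AnomalousDissipation.AnomalousDissipation.Theorems.RobustLoudUpgrade.LsFamilyPeriodic

end
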